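/-
Origin: expansion seat `planner-pub-hodgecm-pv10-g4-0`, handover #5 2026-08-18T11:06:21Z (`HOME/pub-hodgecm-pv10-g4/lean/Pv10g4/TorsionFreeAction.lean`, md5 5c3a79cd, 164 lines);
landed by the gen-7 packager in gate run 28 as `HodgeCM/PerL34/TorsionFreeAction.lean` (import ^import Pv[0-9]+g[0-9]+\.→import HodgeCM.PerL34. ×1; stripped 4 #print/#check/#eval lines).
-/
/-
Copyright: pub-hodgecm formalisation cell (harness21, 2026). New file (not vendored).
Origin: HOME/pub-hodgecm-pv10-g4/lean/Pv10g4/TorsionFreeAction.lean (WIP module `Pv10g4.TorsionFreeAction`;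
intended final place `HodgeCM/PerL34/TorsionFreeAction.lean` = module `HodgeCM.PerL34.TorsionFreeAction`)
(seat planner-pub-hodgecm-pv10-g4-0, DAG-NODE PROVER #10 gen 4; Godement lane, set-up hygiene for PerL v5 §1.2).
Imports at landing: `Pv10g4.CongruenceLattice` ↦ `HodgeCM.PerL34.CongruenceLattice` (this seat's #4); lands after it.
-/
import Summits.HodgeConjecture.HodgeCM.PerL34.CongruenceLattice

/-!
# Torsion-free discrete subgroups act freely on `A / C` (PerL v5 ll. 72–73, KERNEL, group level)

PerL v5 ll. 72–73: "A congruence subgroup is `Γ = G_U(L₀) ∩ K_f` for some compact open `K_f`; for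
torsion-free `Γ`, `P^L_Γ := Γ\𝔹²` is a **smooth** projective surface".  With `𝔹² = G_U(ℝ)/K_∞` (times a point
for the compact factors), smoothness of `Γ\𝔹²` rests on two group-theoretic facts about the discrete subgroup
`Γ ≤ A := G_U(ℝ)` and the compact subgroup `C := K_∞`:

* the isotropy group of every point of `A/C` in `Γ` is FINITE — it is `Γ ∩ aCa⁻¹`, a discrete closed subset
  of a compact set (`finite_stabilizer_inter`, `finite_stabilizer_inf`; this is the orbifold statement, no
  torsion hypothesis);
* hence, if `Γ` is torsion-free (`∀ γ ∈ Γ, IsOfFinOrder γ → γ = 1` — literally the shape of the field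
  `HodgeCM.Level.torsionFree`), `Γ` acts FREELY on `A/C`: `stabilizer_inf_eq_bot_of_torsionFree`,
  `smul_eq_self_iff_eq_one_of_torsionFree`.

§2 specialises to the Godement lane: `A := Uinf L V.Hm = G_U(ℝ)`, `Γ := congruenceLattice L V.Hm K_f`
(discrete for compact `K_f`: `discreteTopology_congruenceLattice`, this seat's #4), `C` any compact subgroup of
`G_U(ℝ)`.  (Projectivity = cocompactness is #4's `compactSpace_quotient_congruenceLattice`; the complex-manifold
structure of `𝔹²` itself is not modelled in the package and is not claimed here.)

Pure kernel mathematics over Mathlib + the package; nothing cited, nothing posited; closures are the standard trio.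
-/

set_option autoImplicit false

noncomputable section

open scoped Pointwise
open Topology
open HodgeCM.PerL34.AdelicUnitaryFactorisation

namespace HodgeCM.PerL34.Godement

/-! ## §1 Abstract: isotropy groups of a discrete subgroup on `A / C`, `C` compact -/

section Abstract

variable {A : Type*} [Group A]

/-- `γ • [a] = [a]` in `A ⧸ C` iff `a⁻¹ γ a ∈ C` (the isotropy group of `[a]` in `A` is `aCa⁻¹`). -/
theorem smul_mk_eq_mk_iff (C : Subgroup A) (γ a : A) :
    γ • (a : A ⧸ C) = (a : A ⧸ C) ↔ a⁻¹ * γ * a ∈ C := by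
  rw [MulAction.Quotient.smul_coe, smul_eq_mul, QuotientGroup.eq]
  constructor
  · intro h
    simpa [mul_inv_rev, mul_assoc] using C.inv_mem h
  · intro h
    simpa [mul_inv_rev, mul_assoc] using C.inv_mem h

/-- The isotropy group of `x ∈ A ⧸ C` in `A`, intersected with `Γ`, lies in `Γ ∩ aCa⁻¹` for any lift `a`. -/
theorem stabilizer_inter_subset (Γ C : Subgroup A) (a : A) :
    (MulAction.stabilizer A (a : A ⧸ C) : Set A) ∩ (Γ : Set A) ⊆
      (fun c : A => a * c * a⁻¹) '' (C : Set A) ∩ (Γ : Set A) := by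
  rintro γ ⟨hγ, hγΓ⟩
  refine ⟨⟨a⁻¹ * γ * a, ?_, by group⟩, hγΓ⟩
  exact (smul_mk_eq_mk_iff C γ a).mp (MulAction.mem_stabilizer_iff.mp hγ)

variable [TopologicalSpace A] [IsTopologicalGroup A] [T2Space A]

/-- **Isotropy groups of a discrete subgroup on `A / C` are finite** (`C` compact): as a set,
`Stab_A(x) ∩ Γ` is finite — it is contained in the compact set `aCa⁻¹` and in the closed discrete set `Γ`. -/
theorem finite_stabilizer_inter (Γ : Subgroup A) [DiscreteTopology Γ] (C : Subgroup A)
    (hC : IsCompact (C : Set A)) (x : A ⧸ C) :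
    ((MulAction.stabilizer A x : Set A) ∩ (Γ : Set A)).Finite := by
  obtain ⟨a, rfl⟩ := QuotientGroup.mk_surjective x
  have hK : IsCompact ((fun c : A => a * c * a⁻¹) '' (C : Set A) ∩ (Γ : Set A)) :=
    (hC.image (by fun_prop)).inter_right Subgroup.isClosed_of_discrete
  have hfin : ((fun c : A => a * c * a⁻¹) '' (C : Set A) ∩ (Γ : Set A)).Finite := by
    refine hK.finite ?_
    exact isDiscrete_iff_discreteTopology.mpr
      (DiscreteTopology.of_subset ‹DiscreteTopology Γ› Set.inter_subset_right)
  exact hfin.subset (stabilizer_inter_subset Γ C a)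

/-- The same, for the subgroup `Stab_A(x) ⊓ Γ` (the isotropy group of `x` in `Γ`): it is a finite group. -/
theorem finite_stabilizer_inf (Γ : Subgroup A) [DiscreteTopology Γ] (C : Subgroup A)
    (hC : IsCompact (C : Set A)) (x : A ⧸ C) :
    Finite (MulAction.stabilizer A x ⊓ Γ : Subgroup A) := by
  have h : ((MulAction.stabilizer A x ⊓ Γ : Subgroup A) : Set A).Finite := by
    rw [Subgroup.coe_inf]
    exact finite_stabilizer_inter Γ C hC x
  exact h.to_subtype

/-- **A torsion-free discrete subgroup acts freely on `A / C`** (`C` compact): the isotropy group of every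
point of `A ⧸ C` in `Γ` is trivial.  `htf` is the shape of `HodgeCM.Level.torsionFree`. -/
theorem stabilizer_inf_eq_bot_of_torsionFree (Γ : Subgroup A) [DiscreteTopology Γ]
    (htf : ∀ γ ∈ Γ, IsOfFinOrder γ → γ = 1) (C : Subgroup A) (hC : IsCompact (C : Set A))
    (x : A ⧸ C) : MulAction.stabilizer A x ⊓ Γ = ⊥ := by
  haveI : Finite (MulAction.stabilizer A x ⊓ Γ : Subgroup A) := finite_stabilizer_inf Γ C hC x
  rw [Subgroup.eq_bot_iff_forall]
  intro γ hγ
  have hord : IsOfFinOrder γ := by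
    simpa using (MulAction.stabilizer A x ⊓ Γ).subtype.isOfFinOrder
      (isOfFinOrder_of_finite (⟨γ, hγ⟩ : (MulAction.stabilizer A x ⊓ Γ : Subgroup A)))
  exact htf γ (Subgroup.mem_inf.mp hγ).2 hord

/-- Free action, element form: for `γ` in a torsion-free discrete `Γ` and any `x ∈ A ⧸ C` (`C` compact),
`γ • x = x ↔ γ = 1`. -/
theorem smul_eq_self_iff_eq_one_of_torsionFree (Γ : Subgroup A) [DiscreteTopology Γ]
    (htf : ∀ γ ∈ Γ, IsOfFinOrder γ → γ = 1) (C : Subgroup A) (hC : IsCompact (C : Set A))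
    {γ : A} (hγ : γ ∈ Γ) (x : A ⧸ C) : γ • x = x ↔ γ = 1 := by
  constructor
  · intro h
    have hmem : γ ∈ MulAction.stabilizer A x ⊓ Γ :=
      Subgroup.mem_inf.mpr ⟨MulAction.mem_stabilizer_iff.mpr h, hγ⟩
    rw [stabilizer_inf_eq_bot_of_torsionFree Γ htf C hC x] at hmem
    exact Subgroup.mem_bot.mp hmem
  · rintro rfl
    exact one_smul A x

end Abstract

/-! ## §2 The Godement lane: congruence subgroups of `G_U` on `G_U(ℝ)/K` -/

section Adelic

variable (L : CMField)

/-- **Isotropy groups of a congruence subgroup of `G_U` on `G_U(ℝ)/C` are finite** (`C ≤ G_U(ℝ)` any compact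
subgroup, e.g. a maximal compact `K_∞`; `K_f` compact; any `V`, no torsion hypothesis): the orbifold statement. -/
theorem _root_.HodgeCM.HermSpace3.finite_stabilizer_congruenceLattice {ι₁ : L →+* ℂ} (V : HermSpace3 L ι₁)
    (Kf : Subgroup (Ufin L V.Hm)) (hKc : IsCompact (Kf : Set (Ufin L V.Hm)))
    (C : Subgroup (Uinf L V.Hm)) (hC : IsCompact (C : Set (Uinf L V.Hm))) (x : Uinf L V.Hm ⧸ C) :
    Finite (MulAction.stabilizer (Uinf L V.Hm) x ⊓ congruenceLattice L V.Hm Kf : Subgroup (Uinf L V.Hm)) := by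
  haveI := HodgeCM.HermSpace3.discreteTopology_congruenceLattice L V Kf hKc
  exact finite_stabilizer_inf (congruenceLattice L V.Hm Kf) C hC x

/-- **PerL v5 ll. 72–73 (KERNEL, group level): a torsion-free congruence subgroup of `G_U` acts FREELY on
`G_U(ℝ)/C`** for every compact subgroup `C ≤ G_U(ℝ)` (so on `𝔹² × pt = G_U(ℝ)/K_∞`). -/
theorem _root_.HodgeCM.HermSpace3.stabilizer_congruenceLattice_eq_bot {ι₁ : L →+* ℂ} (V : HermSpace3 L ι₁)
    (Kf : Subgroup (Ufin L V.Hm)) (hKc : IsCompact (Kf : Set (Ufin L V.Hm)))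
    (htf : ∀ γ ∈ congruenceLattice L V.Hm Kf, IsOfFinOrder γ → γ = 1)
    (C : Subgroup (Uinf L V.Hm)) (hC : IsCompact (C : Set (Uinf L V.Hm))) (x : Uinf L V.Hm ⧸ C) :
    MulAction.stabilizer (Uinf L V.Hm) x ⊓ congruenceLattice L V.Hm Kf = ⊥ := by
  haveI := HodgeCM.HermSpace3.discreteTopology_congruenceLattice L V Kf hKc
  exact stabilizer_inf_eq_bot_of_torsionFree (congruenceLattice L V.Hm Kf) htf C hC x

/-- (Ported verbatim from the HodgeCMPerL package; no docstring in the source.) -/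
theorem _root_.HodgeCM.HermSpace3.smul_eq_self_iff_of_torsionFree {ι₁ : L →+* ℂ} (V : HermSpace3 L ι₁)
    (Kf : Subgroup (Ufin L V.Hm)) (hKc : IsCompact (Kf : Set (Ufin L V.Hm)))
    (htf : ∀ γ ∈ congruenceLattice L V.Hm Kf, IsOfFinOrder γ → γ = 1)
    (C : Subgroup (Uinf L V.Hm)) (hC : IsCompact (C : Set (Uinf L V.Hm)))
    {γ : Uinf L V.Hm} (hγ : γ ∈ congruenceLattice L V.Hm Kf) (x : Uinf L V.Hm ⧸ C) :
    γ • x = x ↔ γ = 1 := by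
  haveI := HodgeCM.HermSpace3.discreteTopology_congruenceLattice L V Kf hKc
  exact smul_eq_self_iff_eq_one_of_torsionFree (congruenceLattice L V.Hm Kf) htf C hC hγ x

end Adelic

end HodgeCM.PerL34.Godement

end

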